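import Summits.CriticalPhenomena.PercolationContinuityZ3.Theses.PercThresholdOne
import Literature.Probability.Percolation.HalfSpaceProofs
import Literature.Probability.Percolation.ConstrainedClusters
import Literature.Probability.Percolation.GrimmettMarstrand
import Literature.Probability.Percolation.SiteConnectionTools

/-!
# Route PercThresholdOne — support item `CriticalConfigWeaves` (stmt-CriticalPhenomena-5264)

WEAVING OF THE CRITICAL CONFIGURATION of bond percolation on `ℤ³`: `P_{p_c}`-almost surely, for
every axis `i`, offset `k` and base point `x`, the clusters of `x` by open paths inside the
coordinate half-spaces `{z | k ≤ z i}` and `{z | z i ≤ k}` are finite.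

Proof (Barsky–Grimmett–Newman 1991 = Grimmett 1999 Thm. (7.35), PROVED in tree as
`BarskyGrimmettNewman1991_Z3_holds : θ_ℍ(p_c(ℤ³)) = 0` for `ℍ = {0 ≤ z 0}` rooted at `0`,
transported by bookkeeping only):

* base point: `ℍ` is connected (`halfSpaceGraph_reachable`) and positivity of `θ` passes between
  adjacent roots (`theta_pos_of_adj`), so `θ_ℍ(y, p_c) = 0` for every `y ∈ ℍ`;
* lattice symmetry: a translation followed by a (signed) coordinate permutation is an
  automorphism of `zdGraph 3` carrying `{k ≤ z i}` (resp. `{z i ≤ k}`) onto `ℍ`, hence an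
  isomorphism of the induced graphs, and `θ` is invariant under isomorphisms (`theta_iso`);
* `θ` of the induced graph is the `P_{p_c}`-probability that the constrained cluster is infinite
  (`theta_induce_eq_real_percolatesVia`), and almost surely (`ω ⊆ E(ℤ³)`) the constrained
  cluster is exactly `{y | ω ∈ openConnIn S x y}` (`openConnIn_eq_openConnVia`,
  `openClusterIn_withinGraph_eq_top`); for `x ∉ S` that set is empty;
* countable intersection over `(i, k, x)` (`ae_all_iff`).
-/

namespace Summit.CriticalPhenomena.PercolationContinuityZ3.Theorems

open MeasureTheory
open Literature.Probability.Percolation Literature.Probability.LatticeModels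

/-- **No half-space percolation at `p_c(ℤ³)` from ANY base point**: `θ_ℍ(y, p_c) = 0` for every
`y ∈ ℍ = {0 ≤ z 0}` — Barsky–Grimmett–Newman at the origin, moved along a path of the connected
graph `ℍ` by the one-edge comparison `p θ_y ≤ θ_x`. -/
theorem criticalConfigWeaves_theta_halfSpace_eq_zero (y : halfSpace 3) :
    theta (halfSpaceGraph 3) y (criticalProbI 3) = 0 := by
  have key : ∀ u z : halfSpace 3, (halfSpaceGraph 3).Reachable u z →
      0 < theta (halfSpaceGraph 3) z (criticalProbI 3) →
      0 < theta (halfSpaceGraph 3) u (criticalProbI 3) := by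
    intro u z huz hpos
    obtain ⟨w⟩ := huz
    induction w with
    | nil => exact hpos
    | cons hab _ ih => exact theta_pos_of_adj _ hab _ (ih hpos)
  by_contra hne
  have hpos : 0 < theta (halfSpaceGraph 3) y (criticalProbI 3) :=
    lt_of_le_of_ne measureReal_nonneg (Ne.symm hne)
  have h0 := key (halfSpaceOrigin 3) y (halfSpaceGraph_reachable _ _) hpos
  have hBGN : theta (halfSpaceGraph 3) (halfSpaceOrigin 3) (criticalProbI 3) = 0 :=
    BarskyGrimmettNewman1991_Z3_holds
  exact h0.ne' hBGN

/-- **No percolation at `p_c(ℤ³)` inside any image of the half-space**: if an automorphism `ψ` of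
`ℤ³` carries `S` onto `ℍ`, then `θ_{ℤ³[S]}(x, p_c) = 0` for every `x ∈ S` (`ψ` restricts to an
isomorphism of induced graphs; `θ` is invariant under isomorphisms). -/
theorem criticalConfigWeaves_theta_induce_eq_zero {S : Set (Site 3)} (ψ : zdGraph 3 ≃g zdGraph 3)
    (hS : ∀ z, z ∈ S ↔ ψ z ∈ halfSpace 3) (x : Site 3) (hx : x ∈ S) :
    theta ((zdGraph 3).induce S) ⟨x, hx⟩ (criticalProbI 3) = 0 := by
  let φ : (zdGraph 3).induce S ≃g halfSpaceGraph 3 :=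
    { toEquiv := ψ.toEquiv.subtypeEquiv hS
      map_rel_iff' := by
        intro a b
        simp only [SimpleGraph.comap_adj, Function.Embedding.coe_subtype, Equiv.subtypeEquiv_apply]
        exact ψ.map_rel_iff' }
  rw [← theta_iso φ ⟨x, hx⟩ (criticalProbI 3)]
  exact criticalConfigWeaves_theta_halfSpace_eq_zero _

/-- **Almost sure finiteness of one constrained cluster**: if an automorphism of `ℤ³` carries `S`
onto `ℍ`, then `P_{p_c}`-a.s. the set of sites joined to `x` by open paths inside `S` is finite
(empty if `x ∉ S`; otherwise it is the constrained cluster, infinite with probability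
`θ_{ℤ³[S]}(x, p_c) = 0`). -/
theorem criticalConfigWeaves_ae_finite {S : Set (Site 3)} (ψ : zdGraph 3 ≃g zdGraph 3)
    (hS : ∀ z, z ∈ S ↔ ψ z ∈ halfSpace 3) (x : Site 3) :
    ∀ᵐ ω ∂(bondPercolation (zdGraph 3) (criticalProbI 3)), {y | ω ∈ openConnIn S x y}.Finite := by
  by_cases hx : x ∈ S
  · have hθ := criticalConfigWeaves_theta_induce_eq_zero ψ hS x hx
    rw [theta_induce_eq_real_percolatesVia (zdGraph 3) S x hx] at hθ
    have hnull : bondPercolation (zdGraph 3) (criticalProbI 3)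
        (percolatesVia (withinGraph (zdGraph 3) S) x) = 0 :=
      (measureReal_eq_zero_iff (by finiteness)).1 hθ
    have hae1 : ∀ᵐ ω ∂(bondPercolation (zdGraph 3) (criticalProbI 3)),
        ω ∉ percolatesVia (withinGraph (zdGraph 3) S) x :=
      measure_eq_zero_iff_ae_notMem.1 hnull
    have hae2 : ∀ᵐ ω ∂(bondPercolation (zdGraph 3) (criticalProbI 3)), ω ⊆ (zdGraph 3).edgeSet :=
      ProbabilityTheory.setBernoulli_ae_subset
    filter_upwards [hae1, hae2] with ω h1 h2
    have hset : {y | ω ∈ openConnIn S x y} = openClusterIn (withinGraph (zdGraph 3) S) ω x := by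
      ext y
      rw [Set.mem_setOf_eq, openConnIn_eq_openConnVia hx y,
        openClusterIn_withinGraph_eq_top (zdGraph 3) S h2 x]
      rfl
    rw [hset]
    exact Set.not_infinite.1 h1
  · refine Filter.Eventually.of_forall fun ω => ?_
    have hempty : {y | ω ∈ openConnIn S x y} = ∅ := by
      ext y
      simp only [Set.mem_setOf_eq, Set.mem_empty_iff_false, iff_false]
      rintro ⟨hx', -⟩
      exact hx hx'
    rw [hempty]
    exact Set.finite_empty

/-- The automorphism "translate by `-k e_i`, then swap coordinates `0` and `i`" of `ℤ³` carries
the half-space `{z | k ≤ z i}` onto `ℍ = {0 ≤ z 0}`. -/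
theorem criticalConfigWeaves_iso_ge (i : Fin 3) (k : ℤ) :
    ∀ z : Site 3, z ∈ {z : Site 3 | k ≤ z i} ↔
      ((zdShiftIso (Pi.single i (-k))).trans (zdSignedPermIso (Equiv.swap 0 i) 1)) z ∈
        halfSpace 3 := by
  intro z
  simp only [halfSpace, Set.mem_setOf_eq, RelIso.trans_apply, zdShiftIso_apply,
    zdSignedPermIso_apply, Site.signedPerm_apply, Equiv.symm_swap, Equiv.swap_apply_left,
    Pi.add_apply, Pi.single_eq_same, Pi.one_apply, Units.val_one, one_mul]
  omega

/-- The automorphism "translate by `-k e_i`, swap coordinates `0` and `i`, flip all signs" of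
`ℤ³` carries the half-space `{z | z i ≤ k}` onto `ℍ = {0 ≤ z 0}`. -/
theorem criticalConfigWeaves_iso_le (i : Fin 3) (k : ℤ) :
    ∀ z : Site 3, z ∈ {z : Site 3 | z i ≤ k} ↔
      ((zdShiftIso (Pi.single i (-k))).trans (zdSignedPermIso (Equiv.swap 0 i) (fun _ => -1))) z ∈
        halfSpace 3 := by
  intro z
  simp only [halfSpace, Set.mem_setOf_eq, RelIso.trans_apply, zdShiftIso_apply,
    zdSignedPermIso_apply, Site.signedPerm_apply, Equiv.symm_swap, Equiv.swap_apply_left,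
    Pi.add_apply, Pi.single_eq_same, Units.coe_neg_one, neg_one_mul]
  omega

/-- **WEAVING OF THE CRITICAL CONFIGURATION** (support item `CriticalConfigWeaves`,
stmt-CriticalPhenomena-5264, of route PercThresholdOne): `P_{p_c}`-almost surely on `ℤ³`, for
every axis `i`, offset `k` and base point `x`, the sets of sites joined to `x` by open paths
inside `{z | k ≤ z i}` and inside `{z | z i ≤ k}` are finite. From Barsky–Grimmett–Newman
(`BarskyGrimmettNewman1991_Z3_holds`, Grimmett 1999 Thm. (7.35)) by lattice symmetry, change of
base point and a countable intersection. -/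
theorem criticalConfigWeaves_proof :
    Summit.CriticalPhenomena.PercolationContinuityZ3.Theses.PercThresholdOne.CriticalConfigWeaves := by
  unfold Summit.CriticalPhenomena.PercolationContinuityZ3.Theses.PercThresholdOne.CriticalConfigWeaves
  refine ae_all_iff.2 fun i => ae_all_iff.2 fun k => ae_all_iff.2 fun x => ?_
  exact (criticalConfigWeaves_ae_finite _ (criticalConfigWeaves_iso_ge i k) x).and
    (criticalConfigWeaves_ae_finite _ (criticalConfigWeaves_iso_le i k) x)

end Summit.CriticalPhenomena.PercolationContinuityZ3.Theorems
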